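import Summits.CriticalPhenomena.PercolationContinuityZ3.Theorems.Transplant.SiteKNLevels
import Summits.CriticalPhenomena.PercolationContinuityZ3.Theorems.Transplant.SiteKNFailLevels
import Literature.Probability.LatticeModels.ProdBernoulliIndependence
import HarnessLib

/-!
# SITE Kozma–Nitzan §4, Lemma 10 — part 2: Step II (a level with many contact vertices)
# (site twin of `L/KozmaNitzanTargetLemma.lean` ll. 905–1270, via the abstract level count `SiteKNFailLevels`)

builds on p205010 (kernel theorem, internal audit signed; external expert review pending).
Lane `prim-bschramm`, class C1a (site percolation on `ℤ³`), seat p1 gen 3, block (α) of the SITE same-`p` witness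
(`SiteSameP.SiteSamePWitnessZd`, socket p217536).  Helper file (`--supports stmt-CriticalPhenomena-4575`).

* `Hev_congr_site` — locality of the level events `H_{t,j}` built from `sFail`/`sDjo`: determined by the vertices of the
  region outside `B⟨j⟩`; `measurableSet_sHev`;
* `SLHyp.real_sHev_inter_sDjo_le` — **the one-level estimate** `P(H_{t,j} ∩ D_j) ≤ (1 − (1−p)^{2dN})·P(H_{t,j})`
  (eq. (18), site form): condition on the contact set `κ` (fewer than `N` vertices); `H_{t,j} ∩ {sKont = κ}` is determined
  by the vertices outside `B⟨j⟩`, the contact NEIGHBOURS of `κ` are at most `2dN` fresh vertices of `B⟨j⟩` of weight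
  `p`, independent of it;
* **`SLHyp.stepII`** — if `P(o ↔ B) > 1 − δ` and the level range `J = [j₀, j₁]`, `j₁ ≤ R`, has at least
  `(1−p)^{−2dN}/δ` levels, then at some level `j ∈ J` there are at least `N` site contact vertices with probability
  `> 1 − 2δ` (`FailLevels.stepII_abstract` with `C = {o ↔ B}`, `G = InSupp`).
[cite: KozmaNitzan2024, §4 p. 18 (Step II, (17)–(18))]
-/

noncomputable section

namespace Summit.CriticalPhenomena.PercolationContinuityZ3.Theorems.Transplant

namespace SiteKN

open MeasureTheory ProbabilityTheory
open Literature.Probability.Percolation Literature.Probability.LatticeModels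
open Literature.Probability.Percolation.KozmaNitzan (LData)
open FailLevels (failAbove Hev Aev mem_failAbove_iff)

variable {d : ℕ} {L : LData d}

/-! ## Locality and measurability of the level events -/

/-- **Locality of `H_{t,j}`** (site): determined by the vertices of the region outside `B⟨j⟩` (all levels of `J` having
`B⟨j'⟩ ⊆ Sfin`). [folklore] -/
theorem Hev_congr_site {N : ℕ} {J : Finset ℕ} (hXS : ∀ j' ∈ J, L.X j' ⊆ L.Sfin) {t j : ℕ}
    {ω ω' : SiteConfig (Site d)} (h : ω ∩ L.region j = ω' ∩ L.region j) :
    ω ∈ Hev (sFail L N) (sDjo L) J t j ↔ ω' ∈ Hev (sFail L N) (sDjo L) J t j := by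
  classical
  have hfa : failAbove (sFail L N) J j ω = failAbove (sFail L N) J j ω' := by
    unfold failAbove
    refine Finset.filter_congr fun j' _ => ?_
    constructor
    · rintro ⟨hlt, hF⟩; exact ⟨hlt, (sFail_congr hlt.le h).1 hF⟩
    · rintro ⟨hlt, hF⟩; exact ⟨hlt, (sFail_congr hlt.le h).2 hF⟩
  simp only [Hev, Set.mem_setOf_eq, hfa, sFail_congr le_rfl h]
  refine and_congr_right fun _ => and_congr_right fun _ => forall₂_congr fun j' hj' => ?_
  refine forall_congr' fun hlt => ?_
  rw [sFail_congr hlt.le h, sDjo_congr hlt (hXS j' hj') h]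

/-- `H_{t,j}` is determined by the region outside `B⟨j⟩`. [folklore] -/
theorem determinedBy_sHev {N : ℕ} {J : Finset ℕ} (hXS : ∀ j' ∈ J, L.X j' ⊆ L.Sfin) (t j : ℕ) :
    DeterminedBy (Hev (sFail L N) (sDjo L) J t j) (L.region j) := by
  rw [determinedBy_iff]
  intro ω ω' hω
  exact Hev_congr_site hXS hω

/-- `H_{t,j}` is measurable. [folklore] -/
theorem measurableSet_sHev {N : ℕ} {J : Finset ℕ} (hXS : ∀ j' ∈ J, L.X j' ⊆ L.Sfin) (t j : ℕ) :
    MeasurableSet (Hev (sFail L N) (sDjo L) J t j) :=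
  ((determinedBy_sHev hXS t j).mono (fun _ hz => hz.2)).measurableSet_of_finset

namespace SLHyp

variable {w : Site d → unitInterval} {p : unitInterval} {D : Finset (Site d)} {R : ℕ}
variable (hL : SLHyp L w p D R)
include hL

/-! ## The one-level estimate (18) -/

/-- **The one-level estimate** `P(H_{t,j} ∩ D_j) ≤ (1 − (1−p)^{2dN}) · P(H_{t,j})` (eq. (18), site form).
[cite: KozmaNitzan2024, §4 p. 18 ((18))] -/
theorem real_sHev_inter_sDjo_le {N : ℕ} {J : Finset ℕ} (hJ : ∀ j' ∈ J, j' ≤ R) {t j : ℕ} (hj : j ∈ J) :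
    (prodBernoulli w).real (Hev (sFail L N) (sDjo L) J t j ∩ sDjo L j) ≤
      (1 - (1 - (p : ℝ)) ^ (2 * d * N)) * (prodBernoulli w).real (Hev (sFail L N) (sDjo L) J t j) := by
  classical
  set μ := prodBernoulli w with hμ
  set r : ℝ := 1 - (1 - (p : ℝ)) ^ (2 * d * N) with hr
  have hXS : ∀ j' ∈ J, L.X j' ⊆ L.Sfin := fun j' hj' z hz => hL.mem_Sfin_of_mem_X (by have := hJ j' hj'; omega) hz
  have hjR : j ≤ R := hJ j hj
  set OB := outerBoundary (zdGraph d) (L.X j) with hOB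
  set H := Hev (sFail L N) (sDjo L) J t j with hH
  -- the pieces
  set B : Finset (Site d) → Set (SiteConfig (Site d)) := fun κ => H ∩ {ω | sKont L j ω = κ} with hB
  set Op : Finset (Site d) → Set (SiteConfig (Site d)) := fun κ => {ω | ∃ y ∈ cNbrs L j κ, y ∈ ω} with hOp
  have hBdet : ∀ κ, DeterminedBy (B κ) (L.region j) := by
    intro κ
    rw [determinedBy_iff]
    intro ω ω' hω
    simp only [hB, Set.mem_inter_iff, Set.mem_setOf_eq]
    rw [hH, Hev_congr_site hXS hω, sKont_congr hω]
  have hBm : ∀ κ, MeasurableSet (B κ) := fun κ => ((hBdet κ).mono (fun _ hz => hz.2)).measurableSet_of_finset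
  have hOpdet : ∀ κ, DeterminedBy (Op κ) (↑(cNbrs L j κ) : Set (Site d)) := by
    intro κ
    rw [determinedBy_iff]
    intro ω ω' hω
    simp only [hOp, Set.mem_setOf_eq]
    refine exists_congr fun y => and_congr_right fun hy => ?_
    have := Set.ext_iff.1 hω y
    simp only [Set.mem_inter_iff, Finset.mem_coe, hy, and_true] at this
    exact this
  have hOpm : ∀ κ, MeasurableSet (Op κ) := fun κ => (hOpdet κ).measurableSet_of_finset
  -- `P(Op κ) ≤ r` when `κ` has fewer than `N` vertices
  have hOp_le : ∀ κ, κ.card < N → μ.real (Op κ) ≤ r := by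
    intro κ hcard
    have hcompl : Op κ = {ω | ∀ y ∈ cNbrs L j κ, y ∉ ω}ᶜ := by
      ext ω; simp [hOp]
    have hclosed : μ.real {ω | ∀ y ∈ cNbrs L j κ, y ∉ ω} = (1 - (p : ℝ)) ^ (cNbrs L j κ).card := by
      rw [hμ, prodBernoulli_real_forall_notMem w (cNbrs L j κ)]
      rw [Finset.prod_congr rfl fun y hy => by rw [hL.w_cNbr (show j ≤ R + 1 by omega) hy], Finset.prod_const]
    have hmeas : MeasurableSet {ω : SiteConfig (Site d) | ∀ y ∈ cNbrs L j κ, y ∉ ω} :=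
      measurableSet_forall_notMem_of_countable (cNbrs L j κ).countable_toSet
    rw [hcompl, measureReal_compl hmeas, probReal_univ, hclosed, hr]
    have hp0 : (0 : ℝ) ≤ 1 - p := sub_nonneg.2 p.2.2
    have hp1' : 1 - (p : ℝ) ≤ 1 := sub_le_self _ p.2.1
    have hle : (cNbrs L j κ).card ≤ 2 * d * N := (card_cNbrs_le j κ).trans (Nat.mul_le_mul_left _ hcard.le)
    linarith [pow_le_pow_of_le_one hp0 hp1' hle]
  -- decompositions over `κ`
  have hdecH : H = ⋃ κ ∈ OB.powerset, B κ := by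
    ext ω
    simp only [Set.mem_iUnion, exists_prop, Finset.mem_powerset, hB, Set.mem_inter_iff, Set.mem_setOf_eq]
    constructor
    · intro hω; exact ⟨sKont L j ω, Finset.filter_subset _ _, hω, rfl⟩
    · rintro ⟨κ, -, hω, -⟩; exact hω
  have hdecHD : H ∩ sDjo L j = ⋃ κ ∈ OB.powerset, (Op κ ∩ B κ) := by
    ext ω
    simp only [Set.mem_iUnion, exists_prop, Finset.mem_powerset, hB, hOp, Set.mem_inter_iff,
      Set.mem_setOf_eq, sDjo]
    constructor
    · rintro ⟨hω, hD⟩; exact ⟨sKont L j ω, Finset.filter_subset _ _, hD, hω, rfl⟩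
    · rintro ⟨κ, -, hD, hω, rfl⟩; exact ⟨hω, hD⟩
  have hdisjB : (↑OB.powerset : Set (Finset (Site d))).PairwiseDisjoint B := by
    intro κ _ κ' _ hne
    rw [Function.onFun, Set.disjoint_left]
    rintro ω ⟨-, h1⟩ ⟨-, h2⟩
    exact hne (h1.symm.trans h2)
  have hdisjOB : (↑OB.powerset : Set (Finset (Site d))).PairwiseDisjoint fun κ => Op κ ∩ B κ := by
    intro κ hκ κ' hκ' hne
    exact (hdisjB hκ hκ' hne).mono Set.inter_subset_right Set.inter_subset_right
  rw [hdecHD, measureReal_biUnion_finset hdisjOB (fun κ _ => (hOpm κ).inter (hBm κ)),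
    hdecH, measureReal_biUnion_finset hdisjB (fun κ _ => hBm κ), Finset.mul_sum]
  refine Finset.sum_le_sum fun κ hκ => ?_
  -- independence of `Op κ` (fresh contact neighbours) from `B κ`
  have hind : μ.real (Op κ ∩ B κ) = μ.real (Op κ) * μ.real (B κ) := by
    rw [hμ]
    refine prodBernoulli_real_inter_of_determinedBy w (cNbrs L j κ) (hOpdet κ) ?_ (hOpm κ) (hBm κ)
    refine (hBdet κ).mono fun z hz hz' => hz.1 ?_
    exact Finset.mem_coe.2 (cNbrs_subset_X j κ (Finset.mem_coe.1 hz'))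
  rw [hind]
  by_cases hcard : κ.card < N
  · exact mul_le_mul_of_nonneg_right (hOp_le κ hcard) measureReal_nonneg
  · have hBempty : B κ = ∅ := by
      ext ω
      simp only [hB, Set.mem_inter_iff, Set.mem_setOf_eq, Set.mem_empty_iff_false, iff_false, not_and]
      intro hω hK
      have hF : ω ∈ sFail L N j := by rw [hH] at hω; exact hω.1
      rw [sFail, Set.mem_setOf_eq, hK] at hF
      exact hcard hF
    rw [hBempty, measureReal_empty, mul_zero, mul_zero]

/-! ## Step II -/

open Classical in
/-- **Step II** (KN p. 18, site form): if `P(o ↔^{site} B) > 1 − δ` and the level range `J = [j₀, j₁]`, `j₁ ≤ R`, has at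
least `(1−p)^{−2dN}/δ` levels, then at some level `j ∈ J` there are at least `N` site contact vertices with probability
`> 1 − 2δ`. [cite: KozmaNitzan2024, §4 p. 18 (Step II)] -/
theorem stepII (hp1 : (p : ℝ) < 1) {N j₀ j₁ : ℕ} (hj₁ : j₁ ≤ R) {δ : ℝ}
    (hJ : 1 / (1 - (p : ℝ)) ^ (2 * d * N) ≤ δ * ((Finset.Icc j₀ j₁).card : ℝ))
    (hreach : 1 - δ < (prodBernoulli w).real (sReachB L)) :
    ∃ j ∈ Finset.Icc j₀ j₁, 1 - 2 * δ < (prodBernoulli w).real (sFail L N j)ᶜ := by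
  set J := Finset.Icc j₀ j₁ with hJdef
  have hJle : ∀ j ∈ J, j ≤ R := fun j hj => (Finset.mem_Icc.1 hj).2.trans hj₁
  have hXS : ∀ j' ∈ J, L.X j' ⊆ L.Sfin := fun j' hj' z hz => hL.mem_Sfin_of_mem_X (by have := hJle j' hj'; omega) hz
  set q : ℝ := (1 - (p : ℝ)) ^ (2 * d * N) with hq
  have hq0 : 0 < q := pow_pos (by linarith) _
  have hq1 : q ≤ 1 := pow_le_one₀ (sub_nonneg.2 p.2.2) (sub_le_self _ p.2.1)
  refine FailLevels.stepII_abstract (prodBernoulli w) hq0 hq1 (fun j => measurableSet_sFail N j)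
    (fun t j => measurableSet_sHev hXS t j) (fun t j hj => ?_) measurableSet_sReachB (real_compl_inSupp w)
    (fun j hj => hL.sReachB_subset_sDjo' (by have := hJle j hj; omega)) hJ hreach
  have := hL.real_sHev_inter_sDjo_le (N := N) hJle (t := t) hj
  rwa [hq]

end SLHyp

end SiteKN

end Summit.CriticalPhenomena.PercolationContinuityZ3.Theorems.Transplant

end
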